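import Literature.Geometry.Kaehler.RiemannianHodgeSmoothProofs
import HarnessLib

/-!
# The Hodge star commutes with the Hodge Laplacian; `⋆` preserves harmonic forms (proofs)

Trunk: Kähler / Hodge (topic `Geometry/Kaehler`); companion of
`Literature/Geometry/Kaehler/RiemannianHodge.lean` (`MForm.hodgeStar`, `mcoderiv`,
`hodgeLaplacian`, `IsHarmonicForm`, `harmonicForms`) and of the named fact
`Literature.NumberTheory.Transcendental.hodgeStar_mem_harmonicForms`
(`Literature/NumberTheory/Transcendental/L2HodgeTheory.lean`).

## Main statements (all proved)

* `Literature.Geometry.Kaehler.hodgeStar_mcoderiv`, `Literature.Geometry.Kaehler.mcoderiv_hodgeStar`: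
  `⋆ δ β = (-1)^{k+1} d ⋆ β` for a `(k+1)`-form `β` and `δ ⋆ α = (-1)^{k+1} ⋆ d α` for a
  `k`-form `α` — pure algebra from `δ = (-1)^{n(p+1)+1} ⋆ d ⋆` (Warner (1983), 6.1 (2)) and
  `⋆⋆ = (-1)^{p(n-p)}` (6.1 (1), `MForm.hodgeStar_hodgeStar_holds`); no smoothness, and the
  metric may be any `Bundle.RiemannianBundle` (no regularity in the base point).
* `Literature.Geometry.Kaehler.hodgeLaplacian_hodgeStar`: **`Δ ⋆ = ⋆ Δ`** on `k`-forms
  (Warner (1983), 6.1 (4), p. 221: "it is a straightforward exercise to check that the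
  Laplacian commutes with `*`, that is, `*Δ = Δ*`"), again unconditionally: besides the two
  identities above only `d (c • β) = c • d β` (`mextDeriv_smul`, no smoothness needed) enters.
* `Literature.Geometry.Kaehler.isSmoothForm_of_mem_harmonicForms`: every element of the span
  `harmonicForms o h` is smooth (unconditionally: a span of smooth forms).
* `Literature.Geometry.Kaehler.IsHarmonicForm.hodgeStar`,
  `Literature.Geometry.Kaehler.isHarmonicForm_hodgeStar_iff`,
  `Literature.Geometry.Kaehler.hodgeStar_mem_harmonicForms_of_mem`: for a *smooth* metric
  (`IsContMDiffRiemannianBundle I ∞`) and an orientation family with smooth volume form, the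
  Hodge star of a harmonic `k`-form is a harmonic `(n-k)`-form, hence `⋆ Hᵏ ⊆ H^{n-k}` — the step
  "since `*Δ = Δ*`, it follows that `*φ` is also harmonic" of Warner's proof of Poincaré duality
  (1983, Thm. 6.13, p. 226). Smoothness of `⋆α` is `IsSmoothForm.hodgeStar`
  (`RiemannianHodgeSmoothProofs.lean`, Warner 4.10 (6)); this is the only place where regularity
  of the metric is used, and it is genuinely needed: for the rough metric of
  `RiemannianHodgeRoughMetric.lean` the smooth `1`-form `dy` is (junk-)harmonic while `⋆dy` is
  not even differentiable (see `Literature/NumberTheory/Transcendental/L2HodgeTheoryStarHarmonicProofs.lean`).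

## Proof of `Δ ⋆ = ⋆ Δ`

Write `⋆δ = ε d⋆` on `(k+1)`-forms and `δ⋆ = ε ⋆d` on `k`-forms with `ε = (-1)^{k+1}`
(`hodgeStar_mcoderiv`, `mcoderiv_hodgeStar`; the parities are `nk + (m+1)k ≡ k² ≡ k` and
`nm + k(m+1) ≡ m(m+1) + k ≡ k (mod 2)` for `n = k + m + 1`). For a `k`-form `α`:
`dδ(⋆α) = ε d⋆dα = ⋆δ(dα)` (second identity, then the first one for the `(k+1)`-form `dα`),
and `δd(⋆α) = ε' δ⋆(δα) = ε'² ⋆dδα = ⋆dδα` with `ε' = (-1)^k` (first identity read as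
`d⋆α = ε' ⋆δα`, then the second one for the `(k-1)`-form `δα`). Adding, `Δ⋆α = ⋆Δα`. The
formal proof follows the four-way case split `(k, m) ∈ {0, ·+1}²` of the definition of
`hodgeLaplacian` (in the extreme degrees one of the two terms is absent on both sides).

## References

* F. W. Warner, *Foundations of Differentiable Manifolds and Lie Groups*, GTM 94, Springer
  (1983): 6.1 (1), (2), (4), pp. 220–221; Thm. 6.13 (proof), p. 226.
-/

noncomputable section

open scoped Manifold ContDiff Topology
open Bundle Module

namespace Literature.Geometry.Kaehler

variable {E : Type*} [NormedAddCommGroup E] [NormedSpace ℝ E] {n : ℕ} [Fact (finrank ℝ E = n)]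
  {H : Type*} [TopologicalSpace H] {I : ModelWithCorners ℝ E H}
  {M : Type*} [TopologicalSpace M] [ChartedSpace H M] [FiniteDimensional ℝ E]
  [RiemannianBundle (fun x : M ↦ TangentSpace I x)] {k m : ℕ}
  (o : (x : M) → Orientation ℝ (TangentSpace I x) (Fin n))

/-! ### `⋆ δ = ± d ⋆` and `δ ⋆ = ± ⋆ d` (pure algebra) -/

/-- **`⋆ δ β = (-1)^{k+1} d ⋆ β`** for a `(k+1)`-form `β` (any fibrewise metric, no smoothness):
with `δ = (-1)^{nk+1} ⋆ d ⋆` on `(k+1)`-forms (`mcoderiv`, Warner (1983), 6.1 (2)) and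
`⋆⋆ = (-1)^{(m+1)k}` on `(m+1)`-forms (`MForm.hodgeStar_hodgeStar_holds`, 6.1 (1)),
`⋆δβ = (-1)^{nk+1} (-1)^{(m+1)k} d⋆β`, and `nk + 1 + (m+1)k ≡ k + 1 (mod 2)` as
`n = k + 1 + m`. (The same identity with the sign written `-(-1)^k` and solved for `d⋆β` is
`mextDeriv_hodgeStar_eq_smul_hodgeStar_mcoderiv` of `RiemannianHodgeAdjointProofs.lean`.)
[cite: WarnerGTM94, 6.1 (1)-(2), p. 220] -/
theorem hodgeStar_mcoderiv (h : (k + 1) + m = n) (h' : k + (m + 1) = n)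
    (β : MForm I M ℝ (k + 1)) :
    MForm.hodgeStar o h' (mcoderiv o h β) =
      ((-1 : ℝ) ^ (k + 1)) • mextDeriv (MForm.hodgeStar o h β) := by
  have hss := MForm.hodgeStar_hodgeStar_holds (o := o) (k := m + 1) (m := k)
  dsimp only [MForm.hodgeStar_hodgeStar] at hss
  simp only [mcoderiv, map_smul, hss, smul_smul]
  congr 1
  rw [← pow_add]
  refine neg_one_pow_congr (Nat.even_add.1 ?_)
  have h2 : n * k + 1 + (m + 1) * k + (k + 1) = 2 * (m * k + k + 1) + k * (k + 1) := by
    rw [← h]; ring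
  rw [h2]
  exact (even_two_mul _).add (Nat.even_mul_succ_self k)

/-- **`δ ⋆ α = (-1)^{k+1} ⋆ d α`** for a `k`-form `α` whose Hodge star has positive degree
`m + 1` (any fibrewise metric, no smoothness): with `δ = (-1)^{nm+1} ⋆ d ⋆` on `(m+1)`-forms
(Warner (1983), 6.1 (2)) and `⋆⋆α = (-1)^{k(m+1)} α` (6.1 (1)), `δ⋆α = (-1)^{nm+1}
(-1)^{k(m+1)} ⋆dα` (using `d (c • α) = c • dα`, `mextDeriv_smul`), and
`nm + 1 + k(m+1) ≡ k + 1 (mod 2)` as `n = k + m + 1`. [cite: WarnerGTM94, 6.1 (1)-(2), p. 220] -/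
theorem mcoderiv_hodgeStar (h : k + (m + 1) = n) (g : (m + 1) + k = n) (h'' : (k + 1) + m = n)
    (α : MForm I M ℝ k) :
    mcoderiv o g (MForm.hodgeStar o h α) =
      ((-1 : ℝ) ^ (k + 1)) • MForm.hodgeStar o h'' (mextDeriv α) := by
  have hss := MForm.hodgeStar_hodgeStar_holds (o := o) (k := k) (m := m + 1)
  dsimp only [MForm.hodgeStar_hodgeStar] at hss
  simp only [mcoderiv, hss, mextDeriv_smul, map_smul, smul_smul]
  congr 1
  rw [← pow_add]
  refine neg_one_pow_congr (Nat.even_add.1 ?_)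
  have h2 : n * m + 1 + k * (m + 1) + (k + 1) = 2 * (k * m + k + 1) + m * (m + 1) := by
    rw [← h]; ring
  rw [h2]
  exact (even_two_mul _).add (Nat.even_mul_succ_self m)

/-- `d ⋆ β = (-1)^{k+1} ⋆ δ β` for a `(k+1)`-form `β`: `hodgeStar_mcoderiv` solved for `d⋆β`
(`(-1)^{k+1} (-1)^{k+1} = 1`). [cite: WarnerGTM94, 6.1 (1)-(2), p. 220] -/
theorem mextDeriv_hodgeStar_eq_pow_smul (h : (k + 1) + m = n) (h' : k + (m + 1) = n)
    (β : MForm I M ℝ (k + 1)) :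
    mextDeriv (MForm.hodgeStar o h β) =
      ((-1 : ℝ) ^ (k + 1)) • MForm.hodgeStar o h' (mcoderiv o h β) := by
  rw [hodgeStar_mcoderiv o h h', smul_smul, ← mul_pow, neg_mul_neg, one_mul, one_pow, one_smul]

/-! ### `Δ ⋆ = ⋆ Δ` -/

/-- **The Hodge Laplacian commutes with the Hodge star**: `Δ (⋆α) = ⋆ (Δα)` for every `k`-form
`α` (`k + m = n`; on the left `Δ` acts on `m`-forms). Warner (1983), 6.1 (4), p. 221 ("the
Laplacian commutes with `*`, that is, `*Δ = Δ*`"). Pure algebra — valid for every fibrewise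
metric `Bundle.RiemannianBundle` and every form, smooth or not: by `hodgeStar_mcoderiv` and
`mcoderiv_hodgeStar`, `dδ⋆α = ± d⋆dα = ⋆δdα` and `δd⋆α = ± δ⋆δα = ⋆dδα`, following the
four-way case split of `hodgeLaplacian` on `(k, m)`. [cite: WarnerGTM94, 6.1 (4), p. 221] -/
theorem hodgeLaplacian_hodgeStar (h : k + m = n) (h' : m + k = n) (α : MForm I M ℝ k) :
    hodgeLaplacian o m k h' (MForm.hodgeStar o h α) =
      MForm.hodgeStar o h (hodgeLaplacian o k m h α) := by
  rcases k with - | k <;> rcases m with - | m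
  · simp [hodgeLaplacian]
  · -- `k = 0`: `Δ⋆α = dδ⋆α = -d⋆dα = ⋆δdα = ⋆Δα`
    simp only [hodgeLaplacian]
    rw [mcoderiv_hodgeStar o h _ (show (0 + 1) + m = n by omega), mextDeriv_smul,
      hodgeStar_mcoderiv o _ h]
  · -- `m = 0`: `Δ⋆α = δd⋆α = ± δ⋆δα = ⋆dδα = ⋆Δα`
    simp only [hodgeLaplacian]
    rw [mextDeriv_hodgeStar_eq_pow_smul o h (show k + (0 + 1) = n by omega), mcoderiv_smul,
      mcoderiv_hodgeStar o _ _ h, smul_smul, ← mul_pow, neg_mul_neg, one_mul, one_pow,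
      one_smul]
  · -- generic degrees
    simp only [hodgeLaplacian, map_add]
    rw [mcoderiv_hodgeStar o h _ (show (k + 1 + 1) + m = n by omega), mextDeriv_smul,
      mextDeriv_hodgeStar_eq_pow_smul o h (show k + (m + 1 + 1) = n by omega), mcoderiv_smul,
      mcoderiv_hodgeStar o _ _ h, smul_smul, ← mul_pow, neg_mul_neg, one_mul, one_pow,
      one_smul, hodgeStar_mcoderiv o _ h]
    exact add_comm _ _

/-! ### Harmonic forms under `⋆` -/

/-- Every element of `harmonicForms o h` (the span of the harmonic `k`-forms) is smooth: a linear
combination of smooth forms is smooth. Unconditional. Warner (1983), Def. 6.7 (`H^p ⊆ E^p(M)`).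
[cite: WarnerGTM94, Def. 6.7, p. 222] -/
theorem isSmoothForm_of_mem_harmonicForms (h : k + m = n) {α : MForm I M ℝ k}
    (hα : α ∈ harmonicForms o h) : IsSmoothForm α := by
  induction hα using Submodule.span_induction with
  | mem x hx => exact hx.1
  | zero => exact isSmoothForm_zero
  | add x y _ _ hx hy => exact hx.add hy
  | smul c x _ hx => exact hx.smul c

section Smooth

variable [IsManifold I ∞ M] [IsContMDiffRiemannianBundle I ∞ E (fun x : M ↦ TangentSpace I x)]

/-- **The Hodge star of a harmonic form is harmonic** (smooth metric, orientation family with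
smooth volume form): `⋆α` is smooth (`IsSmoothForm.hodgeStar`, Warner (1983), 4.10 (6)) and
`Δ⋆α = ⋆Δα = 0` (`hodgeLaplacian_hodgeStar`, 6.1 (4)). This is the step "since `*Δ = Δ*`, it
follows that `*φ` is also harmonic" in Warner's proof of Poincaré duality, Thm. 6.13, p. 226.
[cite: WarnerGTM94, Thm. 6.13 (proof), p. 226] -/
theorem IsHarmonicForm.hodgeStar (ho : IsSmoothForm (riemannianVolumeForm o)) (h : k + m = n)
    (h' : m + k = n) {α : MForm I M ℝ k} (hα : IsHarmonicForm o h α) :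
    IsHarmonicForm o h' (MForm.hodgeStar o h α) :=
  ⟨IsSmoothForm.hodgeStar o ho h hα.1, by rw [hodgeLaplacian_hodgeStar o h h', hα.2, map_zero]⟩

/-- For a smooth metric, a `k`-form is harmonic iff its Hodge star is (`⋆⋆ = ±1`).
Warner (1983), 6.1 (1), (4); Thm. 6.13 (proof). [cite: WarnerGTM94, Thm. 6.13 (proof), p. 226] -/
theorem isHarmonicForm_hodgeStar_iff (ho : IsSmoothForm (riemannianVolumeForm o)) (h : k + m = n)
    (h' : m + k = n) (α : MForm I M ℝ k) :
    IsHarmonicForm o h' (MForm.hodgeStar o h α) ↔ IsHarmonicForm o h α := by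
  refine ⟨fun hα ↦ ?_, fun hα ↦ hα.hodgeStar o ho h h'⟩
  have hss := MForm.hodgeStar_hodgeStar_holds (o := o) (k := k) (m := m) h h' α
  have h2 := (hα.hodgeStar o ho h' h).smul o h ((-1 : ℝ) ^ (k * m))
  rwa [hss, smul_smul, ← mul_pow, neg_mul_neg, one_mul, one_pow, one_smul] at h2

/-- **`⋆ Hᵏ ⊆ H^{n-k}`** for a smooth metric: the Hodge star maps the space of harmonic
`k`-forms into the space of harmonic `m`-forms (`k + m = n`), since it is linear and maps
harmonic forms to harmonic forms (`IsHarmonicForm.hodgeStar`). Warner (1983), Thm. 6.13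
(proof), p. 226. [cite: WarnerGTM94, Thm. 6.13 (proof), p. 226] -/
theorem hodgeStar_mem_harmonicForms_of_mem (ho : IsSmoothForm (riemannianVolumeForm o))
    (h : k + m = n) (h' : m + k = n) {α : MForm I M ℝ k} (hα : α ∈ harmonicForms o h) :
    MForm.hodgeStar o h α ∈ harmonicForms o h' := by
  have hle : harmonicForms o h ≤ (harmonicForms o h').comap (MForm.hodgeStar o h) :=
    Submodule.span_le.2 fun β hβ ↦ subset_harmonicForms o h' (hβ.hodgeStar o ho h h')
  exact hle hα

/-- For a smooth metric, `⋆` maps `Hᵏ` *onto* `H^{n-k}`: `Hᵐ = ⋆ Hᵏ` as submodules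
(`⋆ Hᵏ ⊆ Hᵐ` and `Hᵐ = ⋆⋆ Hᵐ ⊆ ⋆ Hᵏ` by `⋆⋆ = ±1`). Warner (1983), Thm. 6.13 (proof),
p. 226. [cite: WarnerGTM94, Thm. 6.13 (proof), p. 226] -/
theorem map_hodgeStar_harmonicForms (ho : IsSmoothForm (riemannianVolumeForm o))
    (h : k + m = n) (h' : m + k = n) :
    (harmonicForms o h).map (MForm.hodgeStar o h) = harmonicForms o h' := by
  refine le_antisymm (Submodule.map_le_iff_le_comap.2 fun α hα ↦
    hodgeStar_mem_harmonicForms_of_mem o ho h h' hα) fun β hβ ↦ ?_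
  have hss := MForm.hodgeStar_hodgeStar_holds (o := o) (k := m) (m := k) h' h β
  refine ⟨((-1 : ℝ) ^ (m * k)) • MForm.hodgeStar o h' β, ?_, ?_⟩
  · exact Submodule.smul_mem _ _ (hodgeStar_mem_harmonicForms_of_mem o ho h' h hβ)
  · rw [map_smul, hss, smul_smul, ← mul_pow, neg_mul_neg, one_mul, one_pow, one_smul]

end Smooth

end Literature.Geometry.Kaehler
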